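import Mathlib.Algebra.Lie.Weights.Killing
import Mathlib.Algebra.Lie.Weights.Cartan
import Mathlib.Algebra.Lie.Weights.RootSystem
import Mathlib.Algebra.Lie.CartanExists
import Mathlib.Algebra.Lie.Rank
import Mathlib.Algebra.Lie.OfAssociative
import Mathlib.Algebra.Lie.AdjointAction.Basic
import Mathlib.Algebra.DirectSum.LinearMap
import Mathlib.LinearAlgebra.Trace
import Mathlib.FieldTheory.IsAlgClosed.Basic
import HarnessLib

/-!
# B1 · rank count: a Killing Lie algebra of endomorphisms preserving a non-trivial decomposition
# has rank at most `dim V − 2`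
(crux stmt-Langlands-14329 `IrreducibilityBySelfDuality.IrreducibleOffSector`, region kit
`prime-rank-transport` (Cruxes/IrreducibleOffSector/RegionSkeleton_prime_rank_transport.lean §S,
`stub_rankCount : RankCount`); `--supports` file; STRUCTURAL: Mathlib imports only)

Statement (= the body of the kit's `RankCount`, verbatim): for `F` algebraically closed of
characteristic zero, `V` finite-dimensional, `L ≤ End_F V` a Lie subalgebra with non-degenerate
Killing form (`LieAlgebra.IsKilling F L`) such that every `x ∈ L` preserves both summands of a
decomposition `V = W₁ ⊕ W₂` with `W₁, W₂ ≠ 0`, one has `rank L + 2 ≤ dim V`.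

Proof (planner, Lines/prime-rank-transport.md §Stubs B1): take a Cartan subalgebra `H = engel x`
(`rank L ≤ dim H`); `W₁`, `W₂` are `H`-modules and decompose into generalised weight spaces
(`LieModule.iSup_genWeightSpace_eq_top'`, `F` algebraically closed, `H` nilpotent); the linear map
`h ↦ (χ(h))_χ` to `F^{weights of W₁} × F^{weights of W₂}` is injective (an `h` in the kernel acts
nilpotently on `V = W₁ ⊕ W₂`, so `ad h` is nilpotent on `L`, hence `h = 0` by
`LieAlgebra.IsKilling.eq_zero_of_isNilpotent_ad_of_mem_isCartanSubalgebra`) and lands in the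
product of the two hyperplanes `∑_χ (mult χ) x_χ = 0` (every element of `H = ⨆ corootSpace α` is a
sum of brackets, hence has trace zero on each stable `Wᵢ`); so
`dim H ≤ (#wts W₁ − 1) + (#wts W₂ − 1) ≤ dim W₁ − 1 + dim W₂ − 1 = dim V − 2`.
Reference: Humphreys, *Introduction to Lie algebras and representation theory*, §8, §15.3;
Bourbaki, *Lie* VII–VIII.
-/

noncomputable section

set_option linter.dupNamespace false

namespace Summit.Langlands.Langlands.Theorems.IrreducibleOffSector.PrimeRankTransport

-- as in Mathlib `Algebra/Lie/OfAssociative` and the kit file: the commutator Lie structure on `End V`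
attribute [local instance] LieRing.ofAssociativeRing LieAlgebra.ofAssociativeAlgebra

open LieModule Module

section LinearAlgebra

variable {F : Type*} [Field F]

/-- Two linear maps with trivial common kernel: `dim E ≤ dim (range f) + dim (range g)`.
[folklore] -/
theorem finrank_le_finrank_range_add {E P Q : Type*} [AddCommGroup E] [Module F E]
    [FiniteDimensional F E] [AddCommGroup P] [Module F P] [FiniteDimensional F P]
    [AddCommGroup Q] [Module F Q] [FiniteDimensional F Q] (f : E →ₗ[F] P) (g : E →ₗ[F] Q)
    (hfg : ∀ e, f e = 0 → g e = 0 → e = 0) :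
    finrank F E ≤ finrank F (LinearMap.range f) + finrank F (LinearMap.range g) := by
  have h1 := f.finrank_range_add_finrank_ker
  have hinj : Function.Injective (g ∘ₗ (LinearMap.ker f).subtype) := by
    rw [← LinearMap.ker_eq_bot, LinearMap.ker_eq_bot']
    rintro ⟨e, he⟩ hge
    rw [LinearMap.mem_ker] at he
    have h0 : e = 0 := hfg e he hge
    simp [h0]
  have h2 : finrank F (LinearMap.ker f) ≤ finrank F (LinearMap.range g) := by
    rw [← LinearMap.finrank_range_of_inj hinj]
    exact Submodule.finrank_mono (LinearMap.range_comp_le_range _ _)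
  omega

/-- An endomorphism of a Lie module which is nilpotent on two Lie submodules spanning the module
is nilpotent. [folklore] -/
theorem isNilpotent_toEnd_of_sup_eq_top {R L M : Type*} [CommRing R] [LieRing L]
    [LieAlgebra R L] [AddCommGroup M] [Module R M] [LieRingModule L M] [LieModule R L M]
    (N₁ N₂ : LieSubmodule R L M) (hN : (N₁ : Submodule R M) ⊔ (N₂ : Submodule R M) = ⊤) (x : L)
    (hx₁ : _root_.IsNilpotent (toEnd R L N₁ x)) (hx₂ : _root_.IsNilpotent (toEnd R L N₂ x)) :
    _root_.IsNilpotent (toEnd R L M x) := by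
  obtain ⟨k₁, hk₁⟩ := hx₁
  obtain ⟨k₂, hk₂⟩ := hx₂
  refine ⟨k₁ + k₂, LinearMap.ext fun m => ?_⟩
  have hm : m ∈ (N₁ : Submodule R M) ⊔ (N₂ : Submodule R M) := hN ▸ Submodule.mem_top
  obtain ⟨m₁, hm₁, m₂, hm₂, rfl⟩ := Submodule.mem_sup.mp hm
  have e₁ : (toEnd R L M x ^ k₁) m₁ = 0 := by
    have := LieSubmodule.coe_toEnd_pow R L M N₁ x ⟨m₁, hm₁⟩ k₁
    rw [hk₁] at this
    simpa using this.symm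
  have e₂ : (toEnd R L M x ^ k₂) m₂ = 0 := by
    have := LieSubmodule.coe_toEnd_pow R L M N₂ x ⟨m₂, hm₂⟩ k₂
    rw [hk₂] at this
    simpa using this.symm
  have e₁' : (toEnd R L M x ^ (k₁ + k₂)) m₁ = 0 := by
    rw [add_comm, pow_add, Module.End.mul_apply, e₁, map_zero]
  have e₂' : (toEnd R L M x ^ (k₁ + k₂)) m₂ = 0 := by
    rw [pow_add, Module.End.mul_apply, e₂, map_zero]
  rw [map_add, e₁', e₂', add_zero, LinearMap.zero_apply]

end LinearAlgebra

section WeightCount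

variable {F : Type*} [Field F]
  {H : Type*} [LieRing H] [LieAlgebra F H] [LieRing.IsNilpotent H]
  {M : Type*} [AddCommGroup M] [Module F M] [LieRingModule H M] [LieModule F H M]
  [FiniteDimensional F M]

/-- If every weight of a module over a nilpotent Lie algebra vanishes at `h`, then `h` acts
nilpotently. [folklore] -/
theorem isNilpotent_toEnd_of_forall_weight_apply_eq_zero [IsAlgClosed F] (h : H)
    (h0 : ∀ χ : Weight F H M, χ h = 0) : _root_.IsNilpotent (toEnd F H M h) := by
  classical
  choose k hk using fun χ : Weight F H M =>
    exists_genWeightSpace_le_ker_of_isNoetherian M (χ : H → F) h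
  refine ⟨Finset.univ.sup k, ?_⟩
  have key : ∀ χ : Weight F H M,
      ((genWeightSpace M (χ : H → F) : LieSubmodule F H M) : Submodule F M) ≤
        LinearMap.ker (toEnd F H M h ^ Finset.univ.sup k) := by
    intro χ m hm
    have hle : k χ ≤ Finset.univ.sup k := Finset.le_sup (Finset.mem_univ χ)
    have hm' := hk χ hm
    have hχ : (χ : H → F) h = 0 := h0 χ
    rw [hχ, map_zero, sub_zero, LinearMap.mem_ker] at hm'
    rw [LinearMap.mem_ker, ← Nat.sub_add_cancel hle, pow_add, Module.End.mul_apply, hm',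
      map_zero]
  have htop : (⊤ : Submodule F M) ≤ LinearMap.ker (toEnd F H M h ^ Finset.univ.sup k) := by
    rw [← LieSubmodule.top_toSubmodule (R := F) (L := H), ← iSup_genWeightSpace_eq_top' F H M,
      LieSubmodule.iSup_toSubmodule]
    exact iSup_le key
  exact LinearMap.ker_eq_top.mp (top_le_iff.mp htop)

/-- The trace of `h` on a module over a nilpotent Lie algebra is `∑_χ (dim M_χ) χ(h)`.
[folklore] -/
theorem trace_toEnd_eq_sum_finrank_mul [IsAlgClosed F] (h : H) :
    LinearMap.trace F M (toEnd F H M h) =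
      ∑ χ : Weight F H M, (finrank F (genWeightSpace M (χ : H → F)) : F) * χ h := by
  classical
  have hxy : ∀ χ : Weight F H M, Set.MapsTo (toEnd F H M h)
      ((genWeightSpace M (χ : H → F) : LieSubmodule F H M) : Submodule F M)
      ((genWeightSpace M (χ : H → F) : LieSubmodule F H M) : Submodule F M) :=
    fun χ m hm ↦ LieSubmodule.lie_mem _ hm
  have hds := DirectSum.isInternal_submodule_of_iSupIndep_of_iSup_eq_top
    (LieSubmodule.iSupIndep_toSubmodule.mpr <| iSupIndep_genWeightSpace' F H M)
    (LieSubmodule.iSup_toSubmodule_eq_top.mpr <| iSup_genWeightSpace_eq_top' F H M)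
  rw [LinearMap.trace_eq_sum_trace_restrict hds hxy]
  refine Finset.sum_congr rfl fun χ _ => ?_
  change LinearMap.trace F (genWeightSpace M (χ : H → F))
    (toEnd F H (genWeightSpace M (χ : H → F)) h) = _
  rw [trace_toEnd_genWeightSpace, nsmul_eq_mul]

/-- A module over a nilpotent Lie algebra has at most `dim M` weights. [folklore] -/
theorem card_weight_le_finrank : Fintype.card (Weight F H M) ≤ finrank F M := by
  classical
  have hind : iSupIndep fun χ : Weight F H M =>
      ((genWeightSpace M (χ : H → F) : LieSubmodule F H M) : Submodule F M) :=
    LieSubmodule.iSupIndep_toSubmodule.mpr (iSupIndep_genWeightSpace' F H M)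
  have hall : ∀ χ : Weight F H M,
      ((genWeightSpace M (χ : H → F) : LieSubmodule F H M) : Submodule F M) ≠ ⊥ := fun χ => by
    rw [Ne, LieSubmodule.toSubmodule_eq_bot]
    exact χ.genWeightSpace_ne_bot
  calc Fintype.card (Weight F H M)
      = Fintype.card {χ : Weight F H M //
          ((genWeightSpace M (χ : H → F) : LieSubmodule F H M) : Submodule F M) ≠ ⊥} :=
        (Fintype.card_congr (Equiv.subtypeUnivEquiv hall)).symm
    _ ≤ finrank F M := hind.subtype_ne_bot_le_finrank

/-- If all elements of a nilpotent Lie algebra act with trace zero on a non-zero module `M`, the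
image of the weight map `h ↦ (χ(h))_χ` has dimension at most `dim M - 1`. [folklore] -/
theorem finrank_range_weightMap_succ_le [IsAlgClosed F] [CharZero F] [Nontrivial M]
    (htr : ∀ h : H, LinearMap.trace F M (toEnd F H M h) = 0)
    (Φ : H →ₗ[F] (Weight F H M → F)) (hΦ : ∀ h χ, Φ h χ = χ h) :
    finrank F (LinearMap.range Φ) + 1 ≤ finrank F M := by
  classical
  have hpos : 0 < finrank F M := finrank_pos
  rcases isEmpty_or_nonempty (Weight F H M) with hemp | hne
  · have hle : finrank F (LinearMap.range Φ) ≤ finrank F (Weight F H M → F) :=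
      Submodule.finrank_le _
    rw [finrank_fintype_fun_eq_card, Fintype.card_eq_zero] at hle
    omega
  have hlt : LinearMap.range Φ ≠ ⊤ := by
    intro htop
    have hmem : (fun _ => (1 : F)) ∈ LinearMap.range Φ := htop ▸ Submodule.mem_top
    obtain ⟨h, hh⟩ := hmem
    have h1 : ∀ χ : Weight F H M, χ h = 1 := fun χ => by rw [← hΦ, hh]
    have ht := htr h
    rw [trace_toEnd_eq_sum_finrank_mul] at ht
    simp only [h1, mul_one] at ht
    rw [← Nat.cast_sum, Nat.cast_eq_zero] at ht
    have hsum : 0 < ∑ χ : Weight F H M, finrank F (genWeightSpace M (χ : H → F)) :=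
      Finset.sum_pos (fun χ _ => zero_lt_finrank_genWeightSpace χ.genWeightSpace_ne_bot)
        Finset.univ_nonempty
    omega
  have hlt' := Submodule.finrank_lt hlt
  rw [finrank_fintype_fun_eq_card] at hlt'
  have hcard := card_weight_le_finrank (F := F) (H := H) (M := M)
  omega

end WeightCount

section KillingTrace

variable {F : Type*} [Field F] [IsAlgClosed F] [CharZero F]
  {L : Type*} [LieRing L] [LieAlgebra F L] [FiniteDimensional F L] [LieAlgebra.IsKilling F L]
  (H : LieSubalgebra F L) [H.IsCartanSubalgebra]
  {M : Type*} [AddCommGroup M] [Module F M] [LieRingModule L M] [LieModule F L M]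

/-- Elements of a Cartan subalgebra of a Lie algebra with non-degenerate Killing form are sums of
brackets (`H = ⨆_α ⁅L_α, L_{-α}⁆`), hence act with trace zero on every module (Mathlib's trace
being `0` outside finite dimension). [cite: Humphreys1972, §8] -/
theorem trace_toEnd_eq_zero_of_mem_cartan {h : L} (hh : h ∈ H) :
    LinearMap.trace F M (toEnd F L M h) = 0 := by
  classical
  let T : L →ₗ[F] F := LinearMap.trace F M ∘ₗ (toEnd F L M).toLinearMap
  have hT : ∀ (α : Weight F H L) (x : H), x ∈ LieAlgebra.corootSpace (α : H → F) →
      T (x : L) = 0 := by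
    intro α x hx
    rw [LieAlgebra.mem_corootSpace] at hx
    have hle : Submodule.span F {⁅y, z⁆ | (y ∈ LieAlgebra.rootSpace H α)
        (z ∈ LieAlgebra.rootSpace H (-α))} ≤ LinearMap.ker T := by
      rw [Submodule.span_le]
      rintro - ⟨y, hy, z, hz, rfl⟩
      simp [T]
    exact hle hx
  have key : ∀ x : H, T (x : L) = 0 := by
    intro x
    have hx : x ∈ ⨆ α : Weight F H L, ⨆ (_ : α.IsNonZero), LieAlgebra.corootSpace (α : H → F) := by
      rw [LieAlgebra.IsKilling.biSup_corootSpace_eq_top]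
      exact LieSubmodule.mem_top x
    refine LieSubmodule.iSup_induction
      (fun α : Weight F H L => ⨆ (_ : α.IsNonZero), LieAlgebra.corootSpace (α : H → F))
      (motive := fun x : H => T (x : L) = 0) hx ?_ ?_ ?_
    · intro α y hy
      by_cases hα : α.IsNonZero
      · rw [iSup_pos hα] at hy
        exact hT α y hy
      · rw [iSup_neg hα, LieSubmodule.mem_bot] at hy
        simp [hy]
    · simp
    · intro y z hy hz
      change T ((y : L) + (z : L)) = 0
      rw [map_add, hy, hz, add_zero]
  simpa [T] using key ⟨h, hh⟩

end KillingTrace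

/-- **B1 · rank count.** A Lie algebra of endomorphisms with non-degenerate Killing form
preserving a non-trivial decomposition `V = W₁ ⊕ W₂` has `rank L + 2 ≤ dim V`.
[cite: Humphreys1972, §15.3] -/
theorem rankCount (F : Type) [Field F] [IsAlgClosed F] [CharZero F] (V : Type) [AddCommGroup V]
    [Module F V] [FiniteDimensional F V] (L : LieSubalgebra F (Module.End F V)) [Module.Finite F L]
    [LieAlgebra.IsKilling F L] (W₁ W₂ : Submodule F V) (hc : IsCompl W₁ W₂) (h₁ : W₁ ≠ ⊥)
    (h₂ : W₂ ≠ ⊥) (hstab : ∀ x ∈ L, (∀ w ∈ W₁, x w ∈ W₁) ∧ ∀ w ∈ W₂, x w ∈ W₂) :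
    LieAlgebra.rank F L + 2 ≤ Module.finrank F V := by
  classical
  -- a Cartan subalgebra `H = engel x`, with `rank L ≤ dim H`
  obtain ⟨x, hx⟩ := LieAlgebra.exists_isCartanSubalgebra_engel F L
  haveI : (LieSubalgebra.engel F x).IsCartanSubalgebra := hx
  set H : LieSubalgebra F L := LieSubalgebra.engel F x
  have hrank : LieAlgebra.rank F L ≤ finrank F H := LieAlgebra.rank_le_finrank_engel F x
  -- the two stable summands as Lie submodules over `L`
  let N₁ : LieSubmodule F L V := ⟨W₁, fun {y} {m} hm => (hstab y y.2).1 m hm⟩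
  let N₂ : LieSubmodule F L V := ⟨W₂, fun {y} {m} hm => (hstab y y.2).2 m hm⟩
  have hN₁ : (N₁ : Submodule F V) = W₁ := rfl
  have hN₂ : (N₂ : Submodule F V) = W₂ := rfl
  have hN₁ne : N₁ ≠ ⊥ := by rw [Ne, ← LieSubmodule.toSubmodule_eq_bot, hN₁]; exact h₁
  have hN₂ne : N₂ ≠ ⊥ := by rw [Ne, ← LieSubmodule.toSubmodule_eq_bot, hN₂]; exact h₂
  haveI : Nontrivial N₁ := (LieSubmodule.nontrivial_iff_ne_bot (N := N₁)).mpr hN₁ne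
  haveI : Nontrivial N₂ := (LieSubmodule.nontrivial_iff_ne_bot (N := N₂)).mpr hN₂ne
  have hfin₁ : finrank F N₁ = finrank F W₁ := rfl
  have hfin₂ : finrank F N₂ = finrank F W₂ := rfl
  have hsum : finrank F W₁ + finrank F W₂ = finrank F V := Submodule.finrank_add_eq_of_isCompl hc
  -- the weight maps `h ↦ (χ h)_χ` of the `H`-modules `W₁`, `W₂`
  let Φ₁ : H →ₗ[F] (Weight F H N₁ → F) := LinearMap.pi fun χ => (χ : H →ₗ[F] F)
  let Φ₂ : H →ₗ[F] (Weight F H N₂ → F) := LinearMap.pi fun χ => (χ : H →ₗ[F] F)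
  have hΦ₁ : ∀ h χ, Φ₁ h χ = χ h := fun _ _ => rfl
  have hΦ₂ : ∀ h χ, Φ₂ h χ = χ h := fun _ _ => rfl
  -- traces vanish on `H` (perfectness of `L` on `H`)
  have htr₁ : ∀ h : H, LinearMap.trace F N₁ (toEnd F H N₁ h) = 0 := fun h =>
    trace_toEnd_eq_zero_of_mem_cartan H (M := N₁) h.2
  have htr₂ : ∀ h : H, LinearMap.trace F N₂ (toEnd F H N₂ h) = 0 := fun h =>
    trace_toEnd_eq_zero_of_mem_cartan H (M := N₂) h.2
  have hc₁ : finrank F (LinearMap.range Φ₁) + 1 ≤ finrank F N₁ :=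
    finrank_range_weightMap_succ_le htr₁ Φ₁ hΦ₁
  have hc₂ : finrank F (LinearMap.range Φ₂) + 1 ≤ finrank F N₂ :=
    finrank_range_weightMap_succ_le htr₂ Φ₂ hΦ₂
  -- the joint weight map is injective
  have hinj : ∀ h : H, Φ₁ h = 0 → Φ₂ h = 0 → h = 0 := by
    intro h e₁ e₂
    have n₁ : _root_.IsNilpotent (toEnd F H N₁ h) :=
      isNilpotent_toEnd_of_forall_weight_apply_eq_zero h fun χ => by rw [← hΦ₁, e₁]; rfl
    have n₂ : _root_.IsNilpotent (toEnd F H N₂ h) :=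
      isNilpotent_toEnd_of_forall_weight_apply_eq_zero h fun χ => by rw [← hΦ₂, e₂]; rfl
    have hsup : (N₁ : Submodule F V) ⊔ (N₂ : Submodule F V) = ⊤ := by
      rw [hN₁, hN₂]; exact hc.sup_eq_top
    have n : _root_.IsNilpotent (toEnd F L V (h : L)) :=
      isNilpotent_toEnd_of_sup_eq_top N₁ N₂ hsup (h : L) n₁ n₂
    have n' : _root_.IsNilpotent ((h : L) : Module.End F V) := by
      have : toEnd F L V (h : L) = ((h : L) : Module.End F V) := LinearMap.ext fun _ => rfl
      rwa [this] at n
    have had : _root_.IsNilpotent (LieAlgebra.ad F L (h : L)) :=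
      LieAlgebra.isNilpotent_ad_of_isNilpotent n'
    have h0 : (h : L) = 0 :=
      LieAlgebra.IsKilling.eq_zero_of_isNilpotent_ad_of_mem_isCartanSubalgebra F L H h.2 had
    exact Subtype.ext h0
  have hH : finrank F H ≤ finrank F (LinearMap.range Φ₁) + finrank F (LinearMap.range Φ₂) :=
    finrank_le_finrank_range_add Φ₁ Φ₂ hinj
  omega

end Summit.Langlands.Langlands.Theorems.IrreducibleOffSector.PrimeRankTransport

end
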